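import Mathlib
import Summits.AtomisticToContinuum.HydrodynamicLimit.Theses.InformationPercolationEngine
import Summits.AtomisticToContinuum.HydrodynamicLimit.Theorems.InformationPercolationEngineKickFairRelEquilibriumMesoTransferCoreC
import HarnessLib

/-!
# `KickFairRelEquilibriumMeso`, line `Sketch` — glue T (`pinchTransfer`, discharging the skeleton's `stub_pinchTransfer`), final assembly

Prover file of the line lead: the glue of the skeleton `Lines/Sketch.lean`, proved (registered sub-goal `pinchTransfer`). From the six
registered stubs of the line — S0′ `BinOscillation`, KC `KeyCount`, E2 `EnergyTail`, E1 (rev 2, restricted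
first-moment collision-count tail under the invariant laws, `∃ σ₀(θ)`), M `PastMeasurable`, R″ (rev 2, restart
fairness on `LG`-typical level sets of the time-zero key, `∃ σ₀(profiles)`) — the crux
`Summit.AtomisticToContinuum.HydrodynamicLimit.Theses.InformationPercolationEngine.KickFairRelEquilibriumMeso`
follows, with the cell sequence `rs N = (N+1)^{-1/4}` (`rs_admissible`).

Proof: choose `σ₀ = min (1/2) (min σ₀^{R″} σ₀^{E1}(θ₁))` with `θ₁, Λ` from the landed global domination
`exists_localGibbsMeasure_le_smul_const`; given `σ, Φ, τ, g, δ` put `δ′ = δ/(4(τ+1))`, `L = 4(τ+1)/δ`, take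
`c, η, N_R` from R″, `K` from E2 at rate `log Λ + 1`, `λ` from E1 at rate `log Λ + η + 3`, `ηp = min(c,1,η)/(8(2K₀+3))`
for S0′ (twice: the data's profiles and the hot homogeneous ones), the finite key sets from KC; for `N` beyond all
thresholds apply `core_estimate` (file `…TransferCore`) with `m = ⌈τ/t_N⌉` windows and bound its right-hand side:
`m(δ′ + 1/L)t_N ≤ (τ+1)(δ′+1/L) = δ/2`, and the three remaining terms are `e^{o(N)} · e^{-Θ(N)} → 0`
(`tendsto_errorTerm`), hence `≤ δ/2` eventually.
-/

noncomputable section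

open MeasureTheory Set Filter Topology
open scoped ENNReal Classical

namespace Summit.AtomisticToContinuum.HydrodynamicLimit.Theorems.KickFairRelEquilibriumMesoLine

open Literature.Analysis.FluidPDE Literature.MathematicalPhysics.KineticTheory
open Summit.AtomisticToContinuum.HydrodynamicLimit.Theorems

/-! ## Asymptotics of the error terms -/

/-- `(N+1)^{3/4} log(N+2) / (N+1) → 0`. [folklore] -/
theorem tendsto_keyEntropy_div :
    Tendsto (fun N : ℕ => ((N : ℝ) + 1) ^ (3 / 4 : ℝ) * Real.log ((N : ℝ) + 2) / ((N : ℝ) + 1)) atTop (𝓝 0) := by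
  -- log(N+2) ≤ log 2 + log(N+1) and log x = o(x^{1/4})
  have h1 : Tendsto (fun N : ℕ => ((N : ℝ) + 1)) atTop atTop :=
    tendsto_atTop_add_const_right _ 1 tendsto_natCast_atTop_atTop
  have hlo := (isLittleO_log_rpow_atTop (show (0 : ℝ) < 1 / 4 by norm_num)).tendsto_div_nhds_zero.comp h1
  have hlo2 : Tendsto (fun N : ℕ => Real.log 2 / ((N : ℝ) + 1) ^ (1 / 4 : ℝ)) atTop (𝓝 0) := by
    refine Tendsto.div_atTop tendsto_const_nhds ?_
    exact (tendsto_rpow_atTop (by norm_num : (0 : ℝ) < 1 / 4)).comp h1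
  have hsum := hlo.add hlo2
  rw [add_zero] at hsum
  -- compare
  have hev : ∀ᶠ N : ℕ in atTop, |((N : ℝ) + 1) ^ (3 / 4 : ℝ) * Real.log ((N : ℝ) + 2) / ((N : ℝ) + 1)| ≤
      |(fun x => Real.log x / x ^ (1 / 4 : ℝ)) ((N : ℝ) + 1) + Real.log 2 / ((N : ℝ) + 1) ^ (1 / 4 : ℝ)| := by
    refine Eventually.of_forall fun N => ?_
    have hN : (0 : ℝ) < (N : ℝ) + 1 := by positivity
    have hlogN : 0 ≤ Real.log ((N : ℝ) + 1) := Real.log_nonneg (by linarith)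
    have hlog2 : 0 ≤ Real.log 2 := Real.log_nonneg (by norm_num)
    have hq : 0 < ((N : ℝ) + 1) ^ (1 / 4 : ℝ) := Real.rpow_pos_of_pos hN _
    have hkey : ((N : ℝ) + 1) ^ (3 / 4 : ℝ) / ((N : ℝ) + 1) = (((N : ℝ) + 1) ^ (1 / 4 : ℝ))⁻¹ := by
      rw [← Real.rpow_neg hN.le, show (-(1 / 4 : ℝ)) = 3 / 4 - 1 by norm_num, Real.rpow_sub hN, Real.rpow_one]
    have hlogle : Real.log ((N : ℝ) + 2) ≤ Real.log ((N : ℝ) + 1) + Real.log 2 := by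
      rw [← Real.log_mul hN.ne' two_ne_zero]
      exact Real.log_le_log (by positivity) (by linarith)
    have hlhs : ((N : ℝ) + 1) ^ (3 / 4 : ℝ) * Real.log ((N : ℝ) + 2) / ((N : ℝ) + 1) =
        Real.log ((N : ℝ) + 2) * (((N : ℝ) + 1) ^ (1 / 4 : ℝ))⁻¹ := by
      rw [← hkey]; ring
    rw [hlhs, abs_of_nonneg (mul_nonneg (Real.log_nonneg (by linarith)) (inv_nonneg.2 hq.le)),
      abs_of_nonneg (add_nonneg (div_nonneg hlogN hq.le) (div_nonneg hlog2 hq.le))]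
    have key := mul_le_mul_of_nonneg_right hlogle (inv_nonneg.2 hq.le)
    rw [add_mul] at key
    simpa only [div_eq_mul_inv] using key
  exact squeeze_zero_norm' hev (by simpa using hsum.norm)

/-- `exp(C (N+1)^{3/4} log(N+2) − b (N+1)) → 0` for `b > 0`. [folklore] -/
theorem tendsto_exp_keyEntropy_sub (C : ℝ) {b : ℝ} (hb : 0 < b) :
    Tendsto (fun N : ℕ => Real.exp (C * ((N : ℝ) + 1) ^ (3 / 4 : ℝ) * Real.log ((N : ℝ) + 2) - b * ((N : ℝ) + 1)))
      atTop (𝓝 0) := by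
  refine Real.tendsto_exp_atBot.comp ?_
  have h1 : Tendsto (fun N : ℕ => ((N : ℝ) + 1)) atTop atTop :=
    tendsto_atTop_add_const_right _ 1 tendsto_natCast_atTop_atTop
  have h2 : Tendsto (fun N : ℕ => C * (((N : ℝ) + 1) ^ (3 / 4 : ℝ) * Real.log ((N : ℝ) + 2) / ((N : ℝ) + 1)) - b)
      atTop (𝓝 (C * 0 - b)) := (tendsto_keyEntropy_div.const_mul C).sub tendsto_const_nhds
  rw [mul_zero, zero_sub] at h2
  have h3 := h1.atTop_mul_neg (by linarith : -b < 0) h2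
  refine h3.congr fun N => ?_
  have hN : ((N : ℝ) + 1) ≠ 0 := by positivity
  rw [mul_sub, mul_comm ((N : ℝ) + 1) (C * _), mul_assoc C, div_mul_cancel₀ _ hN]
  ring

/-- `(N+1) e^{-a(N+1)} → 0` for `a > 0`. [folklore] -/
theorem tendsto_linear_mul_exp_neg {a : ℝ} (ha : 0 < a) :
    Tendsto (fun N : ℕ => ((N : ℝ) + 1) * Real.exp (-(a * ((N : ℝ) + 1)))) atTop (𝓝 0) := by
  have h1 : Tendsto (fun N : ℕ => a * ((N : ℝ) + 1)) atTop atTop :=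
    (tendsto_atTop_add_const_right _ 1 tendsto_natCast_atTop_atTop).const_mul_atTop ha
  have h2 := (Real.tendsto_pow_mul_exp_neg_atTop_nhds_zero 1).comp h1
  have h3 := h2.const_mul a⁻¹
  rw [mul_zero] at h3
  refine h3.congr fun N => ?_
  simp only [Function.comp, pow_one]
  field_simp

/-- `e^{-(N+1)} → 0`. [folklore] -/
theorem tendsto_exp_neg_succ : Tendsto (fun N : ℕ => Real.exp (-((N : ℝ) + 1))) atTop (𝓝 0) :=
  Real.tendsto_exp_atBot.comp (tendsto_neg_atTop_atBot.comp
    (tendsto_atTop_add_const_right _ 1 tendsto_natCast_atTop_atTop))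

/-! ## Windows -/

/-- **The number of windows** `m = ⌈τ/t_N⌉`: positive, window length `τ/m ≤ t_N`, `m t_N ≤ τ + 1`, `m ≤ (τ+1)(N+1)`. [folklore] -/
theorem windows_count_facts {τ : ℝ} (hτ : 0 < τ) (N : ℕ) :
    0 < ⌈τ / tN N⌉₊ ∧ τ / ((⌈τ / tN N⌉₊ : ℕ) : ℝ) ≤ tN N ∧ ((⌈τ / tN N⌉₊ : ℕ) : ℝ) * tN N ≤ τ + 1 ∧
      ((⌈τ / tN N⌉₊ : ℕ) : ℝ) ≤ (τ + 1) * ((N : ℝ) + 1) := by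
  set m := ⌈τ / tN N⌉₊ with hm
  have htN := tN_pos N
  have hm0 : 0 < m := Nat.ceil_pos.2 (div_pos hτ htN)
  have hmR : (0 : ℝ) < m := by exact_mod_cast hm0
  have hm_le : (m : ℝ) ≤ τ / tN N + 1 := (Nat.ceil_lt_add_one (div_pos hτ htN).le).le
  have hceil : τ / tN N ≤ m := Nat.le_ceil _
  have hN1 : (1 : ℝ) ≤ (N : ℝ) + 1 := by linarith [(Nat.cast_nonneg N : (0 : ℝ) ≤ N)]
  refine ⟨hm0, ?_, ?_, ?_⟩
  · rw [div_le_iff₀ hmR]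
    calc τ = τ / tN N * tN N := by field_simp
      _ ≤ (m : ℝ) * tN N := mul_le_mul_of_nonneg_right hceil htN.le
      _ = tN N * m := mul_comm _ _
  · calc (m : ℝ) * tN N ≤ (τ / tN N + 1) * tN N := mul_le_mul_of_nonneg_right hm_le htN.le
      _ = τ + tN N := by field_simp
      _ ≤ τ + 1 := by linarith [tN_le_one N]
  · have hinv : (tN N)⁻¹ ≤ (N : ℝ) + 1 := by
      unfold tN
      rw [Real.rpow_neg (by positivity), inv_inv]
      calc ((N : ℝ) + 1) ^ (1 / 3 : ℝ) ≤ ((N : ℝ) + 1) ^ (1 : ℝ) :=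
            Real.rpow_le_rpow_of_exponent_le hN1 (by norm_num)
        _ = (N : ℝ) + 1 := Real.rpow_one _
    calc (m : ℝ) ≤ τ / tN N + 1 := hm_le
      _ = τ * (tN N)⁻¹ + 1 := by rw [div_eq_mul_inv]
      _ ≤ τ * ((N : ℝ) + 1) + ((N : ℝ) + 1) := add_le_add (mul_le_mul_of_nonneg_left hinv hτ.le) hN1
      _ = (τ + 1) * ((N : ℝ) + 1) := by ring

/-- **The windows** `(w_k, w_{k+1}]`, `w_k = kτ/m`, `k < m`: inside `[0, τ]`, increasing, of length `τ/m ≤ t`. [folklore] -/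
theorem window_facts {τ : ℝ} (hτ : 0 < τ) {m : ℕ} (hm : 0 < m) {t : ℝ} (hwin : τ / (m : ℝ) ≤ t) {k : ℕ}
    (hk : k < m) :
    0 ≤ wEnd τ m k ∧ wEnd τ m k ≤ wEnd τ m (k + 1) ∧ wEnd τ m (k + 1) ≤ τ ∧ wEnd τ m (k + 1) ≤ wEnd τ m k + t := by
  have hmR : (0 : ℝ) < m := by exact_mod_cast hm
  unfold wEnd
  refine ⟨by positivity, ?_, ?_, ?_⟩
  · refine div_le_div_of_nonneg_right ?_ hmR.le
    push_cast; nlinarith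
  · rw [div_le_iff₀ hmR]
    have : ((k : ℝ) + 1) ≤ m := by exact_mod_cast hk
    push_cast; nlinarith
  · have : ((k + 1 : ℕ) : ℝ) * τ / (m : ℝ) = (k : ℝ) * τ / (m : ℝ) + τ / (m : ℝ) := by push_cast; ring
    rw [this]; linarith

/-! ## The explicit error term -/

/-- **The error term of the glue tends to zero**: with `κ = min(c,1,η)/8` the three pieces are
`e^{-(N+1)}`, `(N+1) e^{3κ(N+1)} (e^{-c(N+1)} + e^{-3(N+1)})`, `e^{C_K (N+1)^{3/4} log(N+2)} e^{2κ(N+1)} e^{-η(N+1)}`. [folklore] -/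
theorem errorTerm_tendsto (A₁ A₂ A₃ CK : ℝ) {c η κ : ℝ} (hc : 0 < c) (hη : 0 < η) (hκ : κ = min (min c 1) η / 8) :
    Tendsto (fun N : ℕ =>
      A₁ * Real.exp (-((N : ℝ) + 1)) +
      A₂ * ((N : ℝ) + 1) * (Real.exp (κ * ((N : ℝ) + 1)) ^ 3 *
        (Real.exp (-(c * ((N : ℝ) + 1))) + Real.exp (-(3 * ((N : ℝ) + 1))))) +
      Real.exp (CK * ((N : ℝ) + 1) ^ (3 / 4 : ℝ) * Real.log ((N : ℝ) + 2)) *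
        (A₃ * Real.exp (κ * ((N : ℝ) + 1)) ^ 2 * Real.exp (-(η * ((N : ℝ) + 1))))) atTop (𝓝 0) := by
  have hmin_c : min (min c 1) η ≤ c := (min_le_left _ _).trans (min_le_left _ _)
  have hmin_1 : min (min c 1) η ≤ 1 := (min_le_left _ _).trans (min_le_right _ _)
  have hmin_η : min (min c 1) η ≤ η := min_le_right _ _
  have hmin_pos : 0 < min (min c 1) η := lt_min (lt_min hc one_pos) hη
  have ha1 : 0 < c - 3 * κ := by
    rw [hκ]
    rcases le_or_gt c 1 with hc1 | hc1
    · have : min (min c 1) η ≤ c := hmin_c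
      nlinarith
    · nlinarith
  have ha2 : 0 < 3 - 3 * κ := by rw [hκ]; nlinarith
  have hb : 0 < η - 2 * κ := by rw [hκ]; nlinarith
  have hΛ3 : ∀ N : ℕ, Real.exp (κ * ((N : ℝ) + 1)) ^ 3 = Real.exp (3 * (κ * ((N : ℝ) + 1))) := fun N => by
    rw [show (3 : ℝ) * (κ * ((N : ℝ) + 1)) = ((3 : ℕ) : ℝ) * (κ * ((N : ℝ) + 1)) by norm_num, Real.exp_nat_mul]
  have hΛ2 : ∀ N : ℕ, Real.exp (κ * ((N : ℝ) + 1)) ^ 2 = Real.exp (2 * (κ * ((N : ℝ) + 1))) := fun N => by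
    rw [show (2 : ℝ) * (κ * ((N : ℝ) + 1)) = ((2 : ℕ) : ℝ) * (κ * ((N : ℝ) + 1)) by norm_num, Real.exp_nat_mul]
  have P1 : Tendsto (fun N : ℕ => Real.exp (-((N : ℝ) + 1))) atTop (𝓝 0) := tendsto_exp_neg_succ
  have P2 : Tendsto (fun N : ℕ => ((N : ℝ) + 1) * (Real.exp (3 * (κ * ((N : ℝ) + 1))) *
      Real.exp (-(c * ((N : ℝ) + 1))))) atTop (𝓝 0) := by
    refine (tendsto_linear_mul_exp_neg ha1).congr fun N => ?_
    rw [← Real.exp_add]; congr 1; ring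
  have P3 : Tendsto (fun N : ℕ => ((N : ℝ) + 1) * (Real.exp (3 * (κ * ((N : ℝ) + 1))) *
      Real.exp (-(3 * ((N : ℝ) + 1))))) atTop (𝓝 0) := by
    refine (tendsto_linear_mul_exp_neg ha2).congr fun N => ?_
    rw [← Real.exp_add]; congr 1; ring
  have P4 : Tendsto (fun N : ℕ => Real.exp (CK * ((N : ℝ) + 1) ^ (3 / 4 : ℝ) * Real.log ((N : ℝ) + 2)) *
      (Real.exp (2 * (κ * ((N : ℝ) + 1))) * Real.exp (-(η * ((N : ℝ) + 1))))) atTop (𝓝 0) := by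
    refine (tendsto_exp_keyEntropy_sub CK hb).congr fun N => ?_
    rw [← Real.exp_add, ← Real.exp_add]; congr 1; ring
  have tot := ((P1.const_mul A₁).add ((P2.add P3).const_mul A₂)).add (P4.const_mul A₃)
  simp only [mul_zero, add_zero] at tot
  refine tot.congr fun N => ?_
  rw [hΛ3 N, hΛ2 N]
  ring

/-! ## The glue -/

/-- **The glue of the line, `pinchTransfer` (registered sub-goal; it discharges the skeleton's glue stub
`stub_pinchTransfer`).** See the module docstring. -/
theorem pinchTransfer :
    BinOscillation → KeyCount → EnergyTail →
    (∀ θ : ℝ, 0 < θ → ∃ σ₀ : ℝ, 0 < σ₀ ∧ ∀ σ : ℝ, 0 < σ → σ < σ₀ → ∀ Φ : (N : ℕ) → Flow σ N, ∀ τ : ℝ, 0 < τ →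
      ∀ M : ℝ, 0 ≤ M → ∃ lam : ℝ, ∃ N₀ : ℕ, ∀ N : ℕ, N₀ ≤ N →
      ∫⁻ z in {z | lam < countFn (Φ N) τ z}, ENNReal.ofReal (countFn (Φ N) τ z)
          ∂(localGibbsLaw σ (fun _ => 1) (fun _ => 0) (fun _ => θ) N (Φ N)) ≤
        ENNReal.ofReal (Real.exp (-(M * ((N : ℝ) + 1))))) →
    PastMeasurable →
    (∀ (a₀ θ₀ : T3 → ℝ) (u₀ : T3 → V3), Continuous a₀ → Continuous θ₀ → Continuous u₀ →
      (∀ x, 0 < a₀ x) → (∀ x, 0 < θ₀ x) →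
      ∃ σ₀ : ℝ, 0 < σ₀ ∧ ∀ σ : ℝ, 0 < σ → σ < σ₀ → ∀ Φ : (N : ℕ) → Flow σ N, ∀ τ : ℝ, 0 < τ →
      ∀ g : V3 × V3 × V3 → ℝ, Continuous g → (∃ C : ℝ, ∀ p, |g p| ≤ C) →
      ∀ δ : ℝ, 0 < δ → ∀ L : ℝ, 0 < L →
      ∃ c : ℝ, 0 < c ∧ ∃ η : ℝ, 0 < η ∧ ∃ N₀ : ℕ, ∀ N : ℕ, N₀ ≤ N →
      ∀ h : Fin (N + 1) → ℕ → Past N → ℝ, (∀ i n, Measurable (h i n)) → (∀ i n p, |h i n p| ≤ 1) →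
      ∀ t₁ t₂ : ℝ, 0 ≤ t₁ → t₁ ≤ t₂ → t₂ ≤ τ → t₂ ≤ t₁ + tN N →
      ∀ z₀ : Phase N,
      ENNReal.ofReal (Real.exp (-(η * ((N : ℝ) + 1)))) ≤
          localGibbsLaw σ a₀ u₀ θ₀ N (Φ N) {z | cellKey (rs N) (rs N) z = cellKey (rs N) (rs N) z₀} →
        Integrable (slotSum (Φ N) τ (rs N) t₁ t₂ g h)
            (localGibbsLaw σ (fun _ => 1) (fun _ => 0) (fun _ => 1) N (Φ N)) ∧
        |∫ z in {z | cellKey (rs N) (rs N) z = cellKey (rs N) (rs N) z₀}, slotSum (Φ N) τ (rs N) t₁ t₂ g h z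
            ∂(localGibbsLaw σ (fun _ => 1) (fun _ => 0) (fun _ => 1) N (Φ N))| ≤
          δ * tN N * (localGibbsLaw σ (fun _ => 1) (fun _ => 0) (fun _ => 1) N (Φ N)
            {z | cellKey (rs N) (rs N) z = cellKey (rs N) (rs N) z₀}).toReal ∧
        localGibbsLaw σ (fun _ => 1) (fun _ => 0) (fun _ => 1) N (Φ N)
            ({z | cellKey (rs N) (rs N) z = cellKey (rs N) (rs N) z₀} ∩
              {z | tN N / L < |slotSum (Φ N) τ (rs N) t₁ t₂ g h z -
                (localGibbsLaw σ (fun _ => 1) (fun _ => 0) (fun _ => 1) N (Φ N)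
                    {z | cellKey (rs N) (rs N) z = cellKey (rs N) (rs N) z₀}).toReal⁻¹ *
                  ∫ z in {z | cellKey (rs N) (rs N) z = cellKey (rs N) (rs N) z₀}, slotSum (Φ N) τ (rs N) t₁ t₂ g h z
                    ∂(localGibbsLaw σ (fun _ => 1) (fun _ => 0) (fun _ => 1) N (Φ N))|}) ≤
          ENNReal.ofReal (Real.exp (-(c * ((N : ℝ) + 1)))) *
            localGibbsLaw σ (fun _ => 1) (fun _ => 0) (fun _ => 1) N (Φ N)
              {z | cellKey (rs N) (rs N) z = cellKey (rs N) (rs N) z₀}) →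
    Summit.AtomisticToContinuum.HydrodynamicLimit.Theses.InformationPercolationEngine.KickFairRelEquilibriumMeso := by
  intro hS0 hKC hE2 hE1 hPM hR
  refine ⟨rs, rs_admissible.1, rs_admissible.2.1, rs_admissible.2.2, ?_⟩
  intro a₀ θ₀ u₀ ha hθ hu ha0 hθ0
  obtain ⟨θ₁, hθ₁, Λ, hΛ, hdomAll⟩ := exists_localGibbsMeasure_le_smul_const ha hθ hu ha0 hθ0
  obtain ⟨σR, hσR, hRall⟩ := hR a₀ θ₀ u₀ ha hθ hu ha0 hθ0
  obtain ⟨σE, hσE, hE1all⟩ := hE1 θ₁ hθ₁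
  refine ⟨min (1 / 2) (min σR σE), by positivity, ?_⟩
  intro σ hσ hσlt Φ τ hτ g hg hgb δ hδ
  have hσ12 : σ < 1 / 2 := hσlt.trans_le (min_le_left _ _)
  have hσ2 : σ ≤ 1 / 2 := hσ12.le
  have hσR' : σ < σR := hσlt.trans_le ((min_le_right _ _).trans (min_le_left _ _))
  have hσE' : σ < σE := hσlt.trans_le ((min_le_right _ _).trans (min_le_right _ _))
  obtain ⟨Cg, hCg⟩ := hgb
  have hCg0 : 0 ≤ Cg := (abs_nonneg _).trans (hCg 0)
  -- the bias target and the relative deviation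
  set δ' : ℝ := δ / (4 * (τ + 1)) with hδ'
  set L : ℝ := 4 * (τ + 1) / δ with hLdef
  have hδ'0 : 0 < δ' := by positivity
  have hL0 : 0 < L := by positivity
  have hbudget : (τ + 1) * (δ' + 1 / L) = δ / 2 := by
    rw [hδ', hLdef]; field_simp; ring
  -- R″
  obtain ⟨c, hc, η, hη, NR, hRN⟩ := hRall σ hσ hσR' Φ τ hτ g hg ⟨Cg, hCg⟩ δ' hδ'0 L hL0
  -- E2 at rate log Λ + 1
  have hlogΛ : 0 ≤ Real.log Λ := Real.log_nonneg hΛ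
  obtain ⟨K, NE2, hE2N⟩ := hE2 θ₁ hθ₁ (Real.log Λ + 1) (by positivity)
  set K₀ : ℝ := max K 0 with hK₀
  have hK₀0 : 0 ≤ K₀ := le_max_right _ _
  -- E1 at rate log Λ + η + 3 (hot law)
  obtain ⟨lam, NE1, hE1N⟩ := hE1all σ hσ hσE' Φ τ hτ (Real.log Λ + η + 3) (by positivity)
  set lam' : ℝ := max lam 0 with hlam'
  have hlam'0 : 0 ≤ lam' := le_max_right _ _
  -- S0′ twice, with tolerance ηp
  set κ₁ : ℝ := min (min c 1) η / 8 with hκ₁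
  set ηp : ℝ := κ₁ / (1 + 2 * (K₀ + 1)) with hηp
  have hκ₁0 : 0 < κ₁ := by rw [hκ₁]; exact div_pos (lt_min (lt_min hc one_pos) hη) (by norm_num)
  have hηp0 : 0 < ηp := by rw [hηp]; exact div_pos hκ₁0 (by positivity)
  have hηpκ : ηp * (1 + 2 * (K₀ + 1)) = κ₁ := by rw [hηp]; field_simp
  obtain ⟨NS1, hS1⟩ := hS0 a₀ θ₀ u₀ ha hθ hu ha0 hθ0 ηp hηp0
  obtain ⟨NS2, hS2⟩ := hS0 (fun _ => 1) (fun _ => θ₁) (fun _ => 0) continuous_const continuous_const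
    continuous_const (fun _ => one_pos) (fun _ => hθ₁) ηp hηp0
  -- KC
  obtain ⟨CK, hKCall⟩ := hKC K₀ hK₀0
  -- the error term and its limit
  obtain ⟨NA, hNA⟩ : ∃ NA : ℕ, ∀ N, NA ≤ N →
      2 * Cg * (lam' + 1) * Real.exp (-((N : ℝ) + 1)) +
      (τ + 1) * ((N : ℝ) + 1) * (Real.exp (κ₁ * ((N : ℝ) + 1)) ^ 3 * (2 * Cg * lam' + δ' + 2 * Cg) *
        (Real.exp (-(c * ((N : ℝ) + 1))) + Real.exp (-(3 * ((N : ℝ) + 1))))) +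
      Real.exp (CK * ((N : ℝ) + 1) ^ (3 / 4 : ℝ) * Real.log ((N : ℝ) + 2)) *
        (4 * Cg * (lam' + 1) * Real.exp (κ₁ * ((N : ℝ) + 1)) ^ 2 * Real.exp (-(η * ((N : ℝ) + 1)))) ≤ δ / 2 := by
    have hlim := errorTerm_tendsto (2 * Cg * (lam' + 1)) ((τ + 1) * (2 * Cg * lam' + δ' + 2 * Cg))
      (4 * Cg * (lam' + 1)) CK hc hη hκ₁
    have := hlim.eventually (gt_mem_nhds (by positivity : (0 : ℝ) < δ / 2))
    obtain ⟨NA, hNA⟩ := eventually_atTop.1 this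
    refine ⟨NA, fun N hN => ?_⟩
    have h := (hNA N hN).le
    have e : (τ + 1) * (2 * Cg * lam' + δ' + 2 * Cg) * ((N : ℝ) + 1) * (Real.exp (κ₁ * ((N : ℝ) + 1)) ^ 3 *
        (Real.exp (-(c * ((N : ℝ) + 1))) + Real.exp (-(3 * ((N : ℝ) + 1))))) =
        (τ + 1) * ((N : ℝ) + 1) * (Real.exp (κ₁ * ((N : ℝ) + 1)) ^ 3 * (2 * Cg * lam' + δ' + 2 * Cg) *
        (Real.exp (-(c * ((N : ℝ) + 1))) + Real.exp (-(3 * ((N : ℝ) + 1))))) := by ring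
    linarith
  refine ⟨max (max NR NE2) (max (max NE1 NS1) (max NS2 NA)), fun N hN h hh hhb => ?_⟩
  have hNR : NR ≤ N := le_trans ((le_max_left _ _).trans (le_max_left _ _)) hN
  have hNE2 : NE2 ≤ N := le_trans ((le_max_right _ _).trans (le_max_left _ _)) hN
  have hNE1 : NE1 ≤ N := le_trans (((le_max_left _ _).trans (le_max_left _ _)).trans (le_max_right _ _)) hN
  have hNS1 : NS1 ≤ N := le_trans (((le_max_right _ _).trans (le_max_left _ _)).trans (le_max_right _ _)) hN
  have hNS2 : NS2 ≤ N := le_trans (((le_max_left _ _).trans (le_max_right _ _)).trans (le_max_right _ _)) hN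
  have hNA' : NA ≤ N := le_trans (((le_max_right _ _).trans (le_max_right _ _)).trans (le_max_right _ _)) hN
  -- the goal is the crux's let-chain; it is the local Gibbs mean of `fullSum`
  change ∫⁻ z, ENNReal.ofReal |fullSum (Φ N) τ (rs N) g h z| ∂(localGibbsLaw σ a₀ u₀ θ₀ N (Φ N)) ≤
    ENNReal.ofReal δ
  -- windows
  obtain ⟨hm0, hwin, hmtN, hmN⟩ := windows_count_facts hτ N
  set m : ℕ := ⌈τ / tN N⌉₊ with hmdef
  -- the windowed R″ hypotheses
  have hRN' : ∀ k, k < m → ∀ z₀ : Phase N,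
      ENNReal.ofReal (Real.exp (-(η * ((N : ℝ) + 1)))) ≤ localGibbsLaw σ a₀ u₀ θ₀ N (Φ N) (keyLevel N z₀) → _ :=
    fun k hk z₀ hfl =>
      have hw := window_facts hτ hm0 hwin hk
      (hRN N hNR h hh hhb (wEnd τ m k) (wEnd τ m (k + 1)) hw.1 hw.2.1 hw.2.2.1 hw.2.2.2 z₀ hfl).2
  -- E2 / E1 at the capped thresholds
  have hE2N' : localGibbsLaw σ (fun _ => 1) (fun _ => 0) (fun _ => θ₁) N (Φ N)
      {z | K₀ * ((N : ℝ) + 1) < kinEnergy z} ≤ ENNReal.ofReal (Real.exp (-((Real.log Λ + 1) * ((N : ℝ) + 1)))) := by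
    refine (measure_mono fun z hz => ?_).trans (hE2N N hNE2 σ hσ hσ12 (Φ N))
    simp only [mem_setOf_eq] at hz ⊢
    exact lt_of_le_of_lt (mul_le_mul_of_nonneg_right (le_max_left _ _) (by positivity)) hz
  have hE1N' : ∫⁻ z in {z | lam' < countFn (Φ N) τ z}, ENNReal.ofReal (countFn (Φ N) τ z)
      ∂(localGibbsLaw σ (fun _ => 1) (fun _ => 0) (fun _ => θ₁) N (Φ N)) ≤
      ENNReal.ofReal (Real.exp (-((Real.log Λ + η + 3) * ((N : ℝ) + 1)))) := by
    refine (lintegral_mono_set fun z hz => ?_).trans (hE1N N hNE1)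
    simp only [mem_setOf_eq] at hz ⊢
    exact lt_of_le_of_lt (le_max_left _ _) hz
  -- the core estimate
  obtain ⟨sN, hscard, hsN⟩ := hKCall N
  have core := core_estimate hPM hσ hσ2 (Φ N) ha hθ hu ha0 hθ0 hθ₁ hΛ (hdomAll σ hσ2 N) hτ hg hCg hh hhb
    hK₀0 hE2N' hlam'0 hE1N' hηp0 (fun z z' hzz' => hS1 N hNS1 σ z z' hzz') (fun z z' hzz' => hS2 N hNS2 σ z z' hzz')
    sN hsN hδ'0 hL0 hη hm0 hRN' le_rfl le_rfl
  rw [hηpκ] at core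
  refine core.trans ?_
  clear core hRN' hRN hE1N hE1N' hE2N hE2N' hS1 hS2 hsN hKCall hdomAll hRall hE1all hS0 hKC hE2 hE1 hR hPM
  -- the arithmetic of the right-hand side
  have hKX0 : 0 ≤ Real.exp (κ₁ * ((N : ℝ) + 1)) ^ 3 * (2 * Cg * lam' + δ' + 2 * Cg) *
      (Real.exp (-(c * ((N : ℝ) + 1))) + Real.exp (-(3 * ((N : ℝ) + 1)))) := by positivity
  have hNK0 : 0 ≤ 4 * Cg * (lam' + 1) * Real.exp (κ₁ * ((N : ℝ) + 1)) ^ 2 * Real.exp (-(η * ((N : ℝ) + 1))) := by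
    positivity
  have hmtN' : (m : ℝ) * ((δ' + 1 / L) * tN N) ≤ δ / 2 := by
    calc (m : ℝ) * ((δ' + 1 / L) * tN N) = (δ' + 1 / L) * ((m : ℝ) * tN N) := by ring
      _ ≤ (δ' + 1 / L) * (τ + 1) := mul_le_mul_of_nonneg_left hmtN (by positivity)
      _ = δ / 2 := by rw [← hbudget]; ring
  have hrest := add_le_add (add_le_add (le_refl (2 * Cg * (lam' + 1) * Real.exp (-((N : ℝ) + 1))))
    (mul_le_mul_of_nonneg_right hmN hKX0)) (mul_le_mul_of_nonneg_right hscard hNK0)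
  have hA := hNA N hNA'
  have htot : (m : ℝ) * ((δ' + 1 / L) * tN N) + 2 * Cg * (lam' + 1) * Real.exp (-((N : ℝ) + 1)) +
      (m : ℝ) * (Real.exp (κ₁ * ((N : ℝ) + 1)) ^ 3 * (2 * Cg * lam' + δ' + 2 * Cg) *
        (Real.exp (-(c * ((N : ℝ) + 1))) + Real.exp (-(3 * ((N : ℝ) + 1))))) +
      (sN.card : ℝ) * (4 * Cg * (lam' + 1) * Real.exp (κ₁ * ((N : ℝ) + 1)) ^ 2 * Real.exp (-(η * ((N : ℝ) + 1)))) ≤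
      δ := by linarith
  calc ENNReal.ofReal ((m : ℝ) * ((δ' + 1 / L) * tN N)) +
        ENNReal.ofReal (2 * Cg * (lam' + 1) * Real.exp (-((N : ℝ) + 1))) +
        ENNReal.ofReal ((m : ℝ) * (Real.exp (κ₁ * ((N : ℝ) + 1)) ^ 3 * (2 * Cg * lam' + δ' + 2 * Cg) *
          (Real.exp (-(c * ((N : ℝ) + 1))) + Real.exp (-(3 * ((N : ℝ) + 1)))))) +
        ENNReal.ofReal ((sN.card : ℝ) * (4 * Cg * (lam' + 1) * Real.exp (κ₁ * ((N : ℝ) + 1)) ^ 2 *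
          Real.exp (-(η * ((N : ℝ) + 1)))))
      = ENNReal.ofReal ((m : ℝ) * ((δ' + 1 / L) * tN N) + 2 * Cg * (lam' + 1) * Real.exp (-((N : ℝ) + 1)) +
          (m : ℝ) * (Real.exp (κ₁ * ((N : ℝ) + 1)) ^ 3 * (2 * Cg * lam' + δ' + 2 * Cg) *
            (Real.exp (-(c * ((N : ℝ) + 1))) + Real.exp (-(3 * ((N : ℝ) + 1))))) +
          (sN.card : ℝ) * (4 * Cg * (lam' + 1) * Real.exp (κ₁ * ((N : ℝ) + 1)) ^ 2 *
            Real.exp (-(η * ((N : ℝ) + 1))))) := by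
        have h1 : 0 ≤ (m : ℝ) * ((δ' + 1 / L) * tN N) := mul_nonneg (by positivity) (mul_nonneg (by positivity)
          (tN_pos N).le)
        rw [← ENNReal.ofReal_add h1 (by positivity), ← ENNReal.ofReal_add (by positivity) (by positivity),
          ← ENNReal.ofReal_add (by positivity) (by positivity)]
    _ ≤ ENNReal.ofReal δ := ENNReal.ofReal_le_ofReal htot

end Summit.AtomisticToContinuum.HydrodynamicLimit.Theorems.KickFairRelEquilibriumMesoLine

end
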